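import Summits.CriticalPhenomena.PercolationContinuityZ3.Theorems.Transplant.FKConnectivityAllQTwoClusterRayleighGraded
import HarnessLib

/-!
# The q-graded two-cluster Rayleigh square, WEIGHTED FORM at every `q > 0` (kernel): the node `TwoClusterRayleighGradedOn` gives
# `Z₁₁(q)·Z₀₀(q) + q⁻²·W(q)² ≤ Z₁₀(q)·Z₀₁(q)` for the `{a ↮ c}`-restricted masses of the random-cluster measure `φ_{w,q}` in the four
# pinned worlds — opposite-seed edge negative correlation for `φ_{w,q}` CONDITIONED ON `a ↮ c`, at EVERY `q > 0` and all weights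

Support file (`--supports stmt-CriticalPhenomena-4575`), FK sub-lane `prim-bschramm-fk-1` (gen 16) of the post-continuity programme;
builds on p205010 (kernel theorem, internal audit signed; external expert review pending).  No definitions, no named facts, no sorries;
standard axioms.

SETTING (`…TwoClusterRayleighGraded.lean`).  `Z_{ij}(q) := φ_{W_{ij},q}({a ↮ c})·Z_{W_{ij},q} = Σ_j q^j·P_{W_{ij}}({a ↮ c} ∩ L_j)`
(`rc_real_mul_Z_eq_sum_levels`) for the pinned weight vectors `W_{ij} = w[e ↦ i][f ↦ j]`, `e = uv`, `f = xy`, `u` sure-joined to `a` and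
`x` to `c`; `W(q) := φ_{W₀₀,q}(𝒜)·Z_{W₀₀,q}`, `𝒜 = threeArmEv a c v y`.  These are the `{a ↮ c}`-restricted random-cluster partition functions
`Σ_{ω ∪ pins ∈ {a↮c}} w^ω (1−w)^{ωᶜ} q^{k(ω ∪ pins)}` of the four worlds.
THEOREM **`rc_sq_ineq_of_gradedOn`**: `TwoClusterRayleighGradedOn V →` for every `w`, every `q > 0` and all such seeds,
`Z₁₁(q)·Z₀₀(q) + (q²)⁻¹·W(q)² ≤ Z₁₀(q)·Z₀₁(q)`; **`rc_seedNegCorr_of_gradedOn`** drops the square.  PROOF: the flips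
`P_{W[g↦1]}(B) = P_{W[g↦0]}(ω ∪ {g} ∈ B)` and the guard `e, f ∉ ω` (fk-1 g15) put all masses under `P_{W₀₀}`; the level expansion and the
folding-fibre identity `P(A)P(B) = Σ_{(M,u)} w(u)w(u∆M)·#(A,B)` turn the three products into fibre sums with coefficients `q^{i+j}`; on a
fibre of positive weight the sure pairs lie in the common part, so the node applies, and summing its slices against `q^s`
(`Σ_{i,j} q^{i+j} = Σ_s q^s Σ_{i+j=s}`, `sum_pow_add_eq_sum_graded`) gives the fibre inequality; the square term is re-indexed by `s ↦ s + 2`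
(levels `0, 1` of `𝒜` are empty).
MEANING.  For `q ≥ 1` the square-free inequality is van den Berg–Häggström–Kahn's Thm. 2.1 for `φ_{w,q}` with `F = 1_e`, `G = 1_f`
(tree: `fkCrossNegAssocOn_of_one_le`); for `q < 1` it is an instance of the conjecture `FKCrossNegAssocPos`; the node asserts it level by
level in `q` with the square, and at `q → 0` it is Conjecture R.  Nothing here is asserted: the node is a hypothesis.
[cite: VandenbergHaggstromKahn2005, Thm. 1.4 (p. 7); Thm. 2.1 (p. 9)] [cite: Grimmett2006, §1.4 eq. (1.20) (p. 15); §3.9 eq. (3.94) (p. 63)]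
[cite: CibulkaHladkyLaCroixWagner2008, Thm. 1 (p. 2)] [cite: Linusson2011, Prop. 2.6]
-/

noncomputable section

namespace Summit.CriticalPhenomena.PercolationContinuityZ3.Theorems

namespace FK

open MeasureTheory Set Literature.Probability.LatticeModels Literature.Probability.Percolation
open Literature.Probability.Percolation.BHK2006 (weight weight_nonneg)
open scoped Classical symmDiff

variable {V : Type*} [Fintype V]

/-! ### Level expansion of a random-cluster mass -/

/-- **`φ_{W,q}(X)·Z_{W,q} = Σ_{j ≤ |V|} q^j·P_W(X ∩ L_j)`.** [cite: Grimmett2006, §1.4 eq. (1.20) (p. 15)] -/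
theorem rc_real_mul_Z_eq_sum_levels (W : Sym2 V → unitInterval) {q : ℝ} (hq : 0 < q) (X : Set (BondConfig V)) :
    (rcMeasureW W q ∅).real X * rcPartitionFunctionW W q ∅ =
      ∑ j ∈ Finset.range (Fintype.card V + 1), q ^ j * (prodBernoulli W).real (X ∩ levelSet V j) := by
  have key := crMeasure_real_mul_eq_sum_levels W (h := fun k => q ^ k) (fun k => pow_pos hq k) X
  rw [crMeasure_pow_eq_rcMeasureW, crPartition_pow] at key
  exact key

/-! ### Summation bookkeeping -/

/-- **`Σ_{i,j ≤ N} q^{i+j} f(i,j) = Σ_{s ≤ 2N} q^s Σ_{i+j=s} f(i,j)`.** [folklore] -/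
theorem sum_pow_add_eq_sum_graded (q : ℝ) (N : ℕ) (f : ℕ → ℕ → ℝ) :
    ∑ i ∈ Finset.range (N + 1), ∑ j ∈ Finset.range (N + 1), q ^ (i + j) * f i j =
      ∑ s ∈ Finset.range (2 * N + 1), q ^ s * ∑ i ∈ Finset.range (N + 1), ∑ j ∈ Finset.range (N + 1), if i + j = s then f i j else 0 := by
  symm
  calc ∑ s ∈ Finset.range (2 * N + 1), q ^ s * ∑ i ∈ Finset.range (N + 1), ∑ j ∈ Finset.range (N + 1), (if i + j = s then f i j else 0)
      = ∑ s ∈ Finset.range (2 * N + 1), ∑ i ∈ Finset.range (N + 1), ∑ j ∈ Finset.range (N + 1),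
          (if i + j = s then q ^ s * f i j else 0) := by
        refine Finset.sum_congr rfl fun s _ => ?_
        rw [Finset.mul_sum]
        refine Finset.sum_congr rfl fun i _ => ?_
        rw [Finset.mul_sum]
        refine Finset.sum_congr rfl fun j _ => ?_
        split_ifs <;> simp
    _ = ∑ i ∈ Finset.range (N + 1), ∑ s ∈ Finset.range (2 * N + 1), ∑ j ∈ Finset.range (N + 1),
          (if i + j = s then q ^ s * f i j else 0) := Finset.sum_comm
    _ = ∑ i ∈ Finset.range (N + 1), ∑ j ∈ Finset.range (N + 1), ∑ s ∈ Finset.range (2 * N + 1),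
          (if i + j = s then q ^ s * f i j else 0) := Finset.sum_congr rfl fun i _ => Finset.sum_comm
    _ = ∑ i ∈ Finset.range (N + 1), ∑ j ∈ Finset.range (N + 1), q ^ (i + j) * f i j := by
        refine Finset.sum_congr rfl fun i hi => Finset.sum_congr rfl fun j hj => ?_
        rw [Finset.mem_range] at hi hj
        have hmem : i + j ∈ Finset.range (2 * N + 1) := Finset.mem_range.2 (by omega)
        rw [Finset.sum_ite_eq, if_pos hmem]

/-- **Re-indexing the square term**: if `g 0 = g 1 = 0` and `g ≥ 0`, then `Σ_{s ≤ K+2} q^s g(s) ≤ q²·Σ_{s ≤ K+2} q^s g(s+2)`. [folklore] -/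
theorem sum_pow_le_sq_mul_sum_shift (q : ℝ) (hq : 0 ≤ q) (K : ℕ) (g : ℕ → ℝ) (h0 : g 0 = 0) (h1 : g 1 = 0) (hg : ∀ s, 0 ≤ g s) :
    ∑ s ∈ Finset.range (K + 3), q ^ s * g s ≤ q ^ 2 * ∑ s ∈ Finset.range (K + 3), q ^ s * g (s + 2) := by
  rw [Finset.sum_range_succ' _ (K + 2), Finset.sum_range_succ' _ (K + 1), h0, h1, mul_zero, mul_zero, add_zero, add_zero, Finset.mul_sum]
  calc ∑ s ∈ Finset.range (K + 1), q ^ (s + 1 + 1) * g (s + 1 + 1)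
      = ∑ s ∈ Finset.range (K + 1), q ^ 2 * (q ^ s * g (s + 2)) :=
        Finset.sum_congr rfl fun s _ => by rw [show s + 1 + 1 = s + 2 from rfl]; ring
    _ ≤ ∑ s ∈ Finset.range (K + 3), q ^ 2 * (q ^ s * g (s + 2)) := by
        refine Finset.sum_le_sum_of_subset_of_nonneg (Finset.range_subset_range.2 (by omega)) fun s _ _ => ?_
        exact mul_nonneg (pow_nonneg hq 2) (mul_nonneg (pow_nonneg hq s) (hg _))

/-! ### A signed three-family folding-fibre principle, positive fibres only -/

/-- **Signed fibrewise domination, positive fibres only**: if on every fibre `(M, u)` of positive weight the combination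
`Σ_k (c_G(k)·#(G₁,G₂) − c_B(k)·#(B₁,B₂) − c_S(k)·#(S₁,S₂)) ≥ 0`, then the same combination of products of `P_w`-masses is `≥ 0`.
[cite: Linusson2011, Prop. 2.6] [cite: VandenbergGandolfi2012, §3 (proof of Thm. 13 from Prop. 2)] -/
theorem sum_three_mul_nonneg_of_fibrewise_pos (p : Sym2 V → unitInterval) (R : Finset (ℕ × ℕ)) (cG cB cS : ℕ × ℕ → ℝ)
    (G₁ G₂ B₁ B₂ S₁ S₂ : ℕ → Set (BondConfig V))
    (h : ∀ M u : BondConfig V, Disjoint u M →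
      0 < weight (fun g => ((p g : unitInterval) : ℝ)) u * weight (fun g => ((p g : unitInterval) : ℝ)) (u ∆ M) →
      0 ≤ ∑ k ∈ R, (cG k * (fibreCount M u (G₁ k.1) (G₂ k.2) : ℝ) - cB k * (fibreCount M u (B₁ k.1) (B₂ k.2) : ℝ) -
        cS k * (fibreCount M u (S₁ k.1) (S₂ k.2) : ℝ))) :
    0 ≤ ∑ k ∈ R, (cG k * ((prodBernoulli p).real (G₁ k.1) * (prodBernoulli p).real (G₂ k.2)) -
      cB k * ((prodBernoulli p).real (B₁ k.1) * (prodBernoulli p).real (B₂ k.2)) -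
      cS k * ((prodBernoulli p).real (S₁ k.1) * (prodBernoulli p).real (S₂ k.2))) := by
  set wt : BondConfig V → ℝ := weight (fun g => ((p g : unitInterval) : ℝ)) with hwt
  have hw0 : ∀ g, 0 ≤ (fun g => ((p g : unitInterval) : ℝ)) g := fun g => (p g).2.1
  have hw1 : ∀ g, (fun g => ((p g : unitInterval) : ℝ)) g ≤ 1 := fun g => (p g).2.2
  have expand : ∀ k ∈ R,
      cG k * ((prodBernoulli p).real (G₁ k.1) * (prodBernoulli p).real (G₂ k.2)) -
        cB k * ((prodBernoulli p).real (B₁ k.1) * (prodBernoulli p).real (B₂ k.2)) -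
        cS k * ((prodBernoulli p).real (S₁ k.1) * (prodBernoulli p).real (S₂ k.2)) =
      ∑ M : BondConfig V, ∑ u : BondConfig V, wt u * wt (u ∆ M) *
        (cG k * (fibreCount M u (G₁ k.1) (G₂ k.2) : ℝ) - cB k * (fibreCount M u (B₁ k.1) (B₂ k.2) : ℝ) -
          cS k * (fibreCount M u (S₁ k.1) (S₂ k.2) : ℝ)) := by
    intro k _
    unfold fibreCount
    rw [prodBernoulli_real_mul_eq_sum_fibres p (G₁ k.1) (G₂ k.2), prodBernoulli_real_mul_eq_sum_fibres p (B₁ k.1) (B₂ k.2),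
      prodBernoulli_real_mul_eq_sum_fibres p (S₁ k.1) (S₂ k.2), Finset.mul_sum, Finset.mul_sum, Finset.mul_sum,
      ← Finset.sum_sub_distrib, ← Finset.sum_sub_distrib]
    refine Finset.sum_congr rfl fun M _ => ?_
    rw [Finset.mul_sum, Finset.mul_sum, Finset.mul_sum, ← Finset.sum_sub_distrib, ← Finset.sum_sub_distrib]
    refine Finset.sum_congr rfl fun u _ => ?_
    ring
  rw [Finset.sum_congr rfl expand, Finset.sum_comm]
  refine Finset.sum_nonneg fun M _ => ?_
  rw [Finset.sum_comm]
  refine Finset.sum_nonneg fun u _ => ?_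
  rw [← Finset.mul_sum]
  have hZ : 0 ≤ wt u * wt (u ∆ M) := mul_nonneg (weight_nonneg hw0 hw1 _) (weight_nonneg hw0 hw1 _)
  by_cases hd : Disjoint u M
  · rcases eq_or_lt_of_le hZ with h0 | hpos
    · rw [← h0, zero_mul]
    · exact mul_nonneg hZ (h M u hd hpos)
  · have hempty : ∀ C D : Set (BondConfig V), fibreCount M u C D = 0 := by
      intro C D
      unfold fibreCount
      rw [Finset.card_eq_zero]
      refine Finset.filter_eq_empty_iff.2 fun a _ ha => hd ?_
      rw [← ha.1]
      exact disjoint_sdiff_self_left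
    simp only [hempty, Nat.cast_zero, mul_zero, sub_zero, Finset.sum_const_zero, le_refl]

/-! ### The weighted graded square inequality for `φ_{w,q}`, every `q > 0` -/

/-- **Conjecture R_q ⇒ `Z₁₁(q)·Z₀₀(q) + (q²)⁻¹·W(q)² ≤ Z₁₀(q)·Z₀₁(q)`** for the `{a ↮ c}`-restricted random-cluster masses of the four
pinned worlds, every weight vector, every `q > 0`, all seeds with `u` sure-joined to `a` and `x` to `c` (sure graph of `w[e↦0][f↦0]`).
[cite: VandenbergHaggstromKahn2005, Thm. 1.4 (p. 7); Thm. 2.1 (p. 9)] [cite: Grimmett2006, §1.4 eq. (1.20) (p. 15)]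
[cite: CibulkaHladkyLaCroixWagner2008, Thm. 1 (p. 2)] [cite: Linusson2011, Prop. 2.6] -/
theorem rc_sq_ineq_of_gradedOn (h : TwoClusterRayleighGradedOn V) (w : Sym2 V → unitInterval) {q : ℝ} (hq : 0 < q)
    (a c u v x y : V)
    (hau : (sureGraph (Function.update (Function.update w s(u, v) 0) s(x, y) 0)).Reachable a u)
    (hcx : (sureGraph (Function.update (Function.update w s(u, v) 0) s(x, y) 0)).Reachable c x) :
    ((rcMeasureW (Function.update (Function.update w s(u, v) 1) s(x, y) 1) q ∅).real (sepEv a c) *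
        rcPartitionFunctionW (Function.update (Function.update w s(u, v) 1) s(x, y) 1) q ∅) *
      ((rcMeasureW (Function.update (Function.update w s(u, v) 0) s(x, y) 0) q ∅).real (sepEv a c) *
        rcPartitionFunctionW (Function.update (Function.update w s(u, v) 0) s(x, y) 0) q ∅) +
      (q ^ 2)⁻¹ * ((rcMeasureW (Function.update (Function.update w s(u, v) 0) s(x, y) 0) q ∅).real (threeArmEv a c v y) *
        rcPartitionFunctionW (Function.update (Function.update w s(u, v) 0) s(x, y) 0) q ∅) ^ 2 ≤
      ((rcMeasureW (Function.update (Function.update w s(u, v) 1) s(x, y) 0) q ∅).real (sepEv a c) *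
        rcPartitionFunctionW (Function.update (Function.update w s(u, v) 1) s(x, y) 0) q ∅) *
      ((rcMeasureW (Function.update (Function.update w s(u, v) 0) s(x, y) 1) q ∅).real (sepEv a c) *
        rcPartitionFunctionW (Function.update (Function.update w s(u, v) 0) s(x, y) 1) q ∅) := by
  set W₀₀ := Function.update (Function.update w s(u, v) 0) s(x, y) 0 with hW₀₀
  set N := Fintype.card V with hN
  have h00e : ((W₀₀ s(u, v) : unitInterval) : ℝ) = 0 := by
    by_cases hef : s(u, v) = s(x, y)
    · rw [hW₀₀, hef, pin_apply_snd]; simp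
    · rw [hW₀₀, pin_apply_fst w hef]; simp
  have h00f : ((W₀₀ s(x, y) : unitInterval) : ℝ) = 0 := by rw [hW₀₀, pin_apply_snd]; simp
  -- the three-arm mass vanishes when `e = f`
  by_cases hef : s(u, v) = s(x, y)
  · have h10 : Function.update (Function.update w s(u, v) 1) s(x, y) 0 = W₀₀ := by
      rw [hW₀₀, hef, Function.update_idem, Function.update_idem]
    have h01 : Function.update (Function.update w s(u, v) 0) s(x, y) 1 = Function.update (Function.update w s(u, v) 1) s(x, y) 1 := by
      rw [hef, Function.update_idem, Function.update_idem]
    have hA : (rcMeasureW W₀₀ q ∅).real (threeArmEv a c v y) * rcPartitionFunctionW W₀₀ q ∅ = 0 := by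
      rw [rc_real_mul_Z_eq_sum_levels W₀₀ hq]
      refine Finset.sum_eq_zero fun j _ => ?_
      suffices hz : (prodBernoulli W₀₀).real (threeArmEv a c v y ∩ levelSet V j) = 0 by rw [hz, mul_zero]
      by_contra hne
      obtain ⟨ω, ⟨⟨hac, -, hcv, -⟩, -⟩, hpos⟩ := exists_mem_weight_pos_of_real_ne_zero _ hne
      have hsure := sureGraph_le_openGraph_of_weight_pos hpos
      rcases Sym2.eq_iff.1 hef with ⟨rfl, rfl⟩ | ⟨rfl, rfl⟩
      · exact hac ((hau.mono hsure).trans (hcx.mono hsure).symm)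
      · exact hcv (hcx.mono hsure)
    rw [h10, h01, hA]
    nlinarith [le_refl ((rcMeasureW W₀₀ q ∅).real (sepEv a c) * rcPartitionFunctionW W₀₀ q ∅)]
  -- `e ≠ f`: everything under `P_{W₀₀}` with the guard `e, f ∉ ω`
  set Gd : Set (BondConfig V) := {ω | s(u, v) ∉ ω ∧ s(x, y) ∉ ω} with hGd
  have hZ11 : ∀ j, (prodBernoulli (Function.update (Function.update w s(u, v) 1) s(x, y) 1)).real (sepEv a c ∩ levelSet V j) =
      (prodBernoulli W₀₀).real (Gd ∩ {ω | insert s(x, y) (insert s(u, v) ω) ∈ sepEv a c ∩ levelSet V j}) := by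
    intro j
    rw [real_guard_eq h00e h00f, real_update_one_eq_real_update_zero_insert, Function.update_comm hef 1 0 w,
      real_update_one_eq_real_update_zero_insert, Function.update_comm (Ne.symm hef) 0 0 w]
    rfl
  have hZ10 : ∀ j, (prodBernoulli (Function.update (Function.update w s(u, v) 1) s(x, y) 0)).real (sepEv a c ∩ levelSet V j) =
      (prodBernoulli W₀₀).real (Gd ∩ {ω | insert s(u, v) ω ∈ sepEv a c ∩ levelSet V j}) := by
    intro j
    rw [real_guard_eq h00e h00f, Function.update_comm hef 1 0 w, real_update_one_eq_real_update_zero_insert,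
      Function.update_comm (Ne.symm hef) 0 0 w]
  have hZ01 : ∀ j, (prodBernoulli (Function.update (Function.update w s(u, v) 0) s(x, y) 1)).real (sepEv a c ∩ levelSet V j) =
      (prodBernoulli W₀₀).real (Gd ∩ {ω | insert s(x, y) ω ∈ sepEv a c ∩ levelSet V j}) := by
    intro j
    rw [real_guard_eq h00e h00f, real_update_one_eq_real_update_zero_insert]
  have hZ00 : ∀ j, (prodBernoulli W₀₀).real (sepEv a c ∩ levelSet V j) = (prodBernoulli W₀₀).real (Gd ∩ (sepEv a c ∩ levelSet V j)) :=
    fun j => (real_guard_eq h00e h00f _).symm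
  have hW : ∀ j, (prodBernoulli W₀₀).real (threeArmEv a c v y ∩ levelSet V j) =
      (prodBernoulli W₀₀).real (Gd ∩ (threeArmEv a c v y ∩ levelSet V j)) := fun j => (real_guard_eq h00e h00f _).symm
  -- names for the guarded level events
  set A₁ : ℕ → Set (BondConfig V) := fun i => Gd ∩ {ω | insert s(x, y) (insert s(u, v) ω) ∈ sepEv a c ∩ levelSet V i} with hA₁
  set A₂ : ℕ → Set (BondConfig V) := fun j => Gd ∩ (sepEv a c ∩ levelSet V j) with hA₂
  set S₀ : ℕ → Set (BondConfig V) := fun i => Gd ∩ (threeArmEv a c v y ∩ levelSet V i) with hS₀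
  set G₁ : ℕ → Set (BondConfig V) := fun i => Gd ∩ {ω | insert s(u, v) ω ∈ sepEv a c ∩ levelSet V i} with hG₁
  set G₂ : ℕ → Set (BondConfig V) := fun j => Gd ∩ {ω | insert s(x, y) ω ∈ sepEv a c ∩ levelSet V j} with hG₂
  set P := prodBernoulli W₀₀ with hP
  set R := Finset.range (N + 1) with hR
  have T11 : (rcMeasureW (Function.update (Function.update w s(u, v) 1) s(x, y) 1) q ∅).real (sepEv a c) *
      rcPartitionFunctionW (Function.update (Function.update w s(u, v) 1) s(x, y) 1) q ∅ = ∑ j ∈ R, q ^ j * P.real (A₁ j) := by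
    rw [rc_real_mul_Z_eq_sum_levels _ hq]
    exact Finset.sum_congr rfl fun j _ => by rw [hZ11]
  have T10 : (rcMeasureW (Function.update (Function.update w s(u, v) 1) s(x, y) 0) q ∅).real (sepEv a c) *
      rcPartitionFunctionW (Function.update (Function.update w s(u, v) 1) s(x, y) 0) q ∅ = ∑ j ∈ R, q ^ j * P.real (G₁ j) := by
    rw [rc_real_mul_Z_eq_sum_levels _ hq]
    exact Finset.sum_congr rfl fun j _ => by rw [hZ10]
  have T01 : (rcMeasureW (Function.update (Function.update w s(u, v) 0) s(x, y) 1) q ∅).real (sepEv a c) *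
      rcPartitionFunctionW (Function.update (Function.update w s(u, v) 0) s(x, y) 1) q ∅ = ∑ j ∈ R, q ^ j * P.real (G₂ j) := by
    rw [rc_real_mul_Z_eq_sum_levels _ hq]
    exact Finset.sum_congr rfl fun j _ => by rw [hZ01]
  have T00 : (rcMeasureW W₀₀ q ∅).real (sepEv a c) * rcPartitionFunctionW W₀₀ q ∅ = ∑ j ∈ R, q ^ j * P.real (A₂ j) := by
    rw [rc_real_mul_Z_eq_sum_levels _ hq]
    exact Finset.sum_congr rfl fun j _ => by rw [hZ00]
  have TS : (rcMeasureW W₀₀ q ∅).real (threeArmEv a c v y) * rcPartitionFunctionW W₀₀ q ∅ = ∑ j ∈ R, q ^ j * P.real (S₀ j) := by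
    rw [rc_real_mul_Z_eq_sum_levels _ hq]
    exact Finset.sum_congr rfl fun j _ => by rw [hW]
  rw [T11, T10, T01, T00, TS]
  -- the three products as double sums with coefficients `q^{i+j}`
  have e11 : (∑ j ∈ R, q ^ j * P.real (A₁ j)) * (∑ j ∈ R, q ^ j * P.real (A₂ j)) =
      ∑ k ∈ R ×ˢ R, q ^ (k.1 + k.2) * (P.real (A₁ k.1) * P.real (A₂ k.2)) := by
    rw [Finset.sum_mul_sum, ← Finset.sum_product']
    exact Finset.sum_congr rfl fun k _ => by rw [pow_add]; ring
  have e10 : (∑ j ∈ R, q ^ j * P.real (G₁ j)) * (∑ j ∈ R, q ^ j * P.real (G₂ j)) =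
      ∑ k ∈ R ×ˢ R, q ^ (k.1 + k.2) * (P.real (G₁ k.1) * P.real (G₂ k.2)) := by
    rw [Finset.sum_mul_sum, ← Finset.sum_product']
    exact Finset.sum_congr rfl fun k _ => by rw [pow_add]; ring
  have eSS : (∑ j ∈ R, q ^ j * P.real (S₀ j)) ^ 2 = ∑ k ∈ R ×ˢ R, q ^ (k.1 + k.2) * (P.real (S₀ k.1) * P.real (S₀ k.2)) := by
    rw [sq, Finset.sum_mul_sum, ← Finset.sum_product']
    exact Finset.sum_congr rfl fun k _ => by rw [pow_add]; ring
  -- the signed fibrewise principle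
  have key := sum_three_mul_nonneg_of_fibrewise_pos W₀₀ (R ×ˢ R) (fun k => q ^ (k.1 + k.2)) (fun k => q ^ (k.1 + k.2))
    (fun k => (q ^ 2)⁻¹ * q ^ (k.1 + k.2)) G₁ G₂ A₁ A₂ S₀ S₀ ?_
  · rw [Finset.sum_sub_distrib, Finset.sum_sub_distrib] at key
    have e3 : ∑ k ∈ R ×ˢ R, (q ^ 2)⁻¹ * q ^ (k.1 + k.2) * (P.real (S₀ k.1) * P.real (S₀ k.2)) =
        (q ^ 2)⁻¹ * ∑ k ∈ R ×ˢ R, q ^ (k.1 + k.2) * (P.real (S₀ k.1) * P.real (S₀ k.2)) := by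
      rw [Finset.mul_sum]; exact Finset.sum_congr rfl fun k _ => by ring
    rw [e3] at key
    rw [e11, e10, eSS]
    linarith
  -- the fibre inequality: on a fibre of positive weight the node applies, and its slices sum to the claim
  intro M u₀ hd hpos
  have hu₀ : 0 < weight (fun g => ((W₀₀ g : unitInterval) : ℝ)) u₀ := by
    rcases eq_or_lt_of_le (weight_nonneg (fun g => (W₀₀ g).2.1) (fun g => (W₀₀ g).2.2) u₀) with h0 | h0
    · rw [← h0, zero_mul] at hpos; exact absurd hpos (lt_irrefl 0)
    · exact h0
  have hsure := sureGraph_le_openGraph_of_weight_pos hu₀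
  have node : ∀ s : ℕ, (gradedCount M u₀ A₁ A₂ s : ℝ) + gradedCount M u₀ S₀ S₀ (s + 2) ≤ gradedCount M u₀ G₁ G₂ s := by
    intro s
    exact_mod_cast h M u₀ hd a c u v x y s (hau.mono hsure) (hcx.mono hsure)
  -- regroup the three double sums by `s = i + j`
  have regroup : ∀ (F₁ F₂ : ℕ → Set (BondConfig V)),
      ∑ k ∈ R ×ˢ R, q ^ (k.1 + k.2) * (fibreCount M u₀ (F₁ k.1) (F₂ k.2) : ℝ) =
        ∑ s ∈ Finset.range (2 * N + 1), q ^ s * (gradedCount M u₀ F₁ F₂ s : ℝ) := by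
    intro F₁ F₂
    rw [Finset.sum_product' (f := fun i j => q ^ (i + j) * (fibreCount M u₀ (F₁ i) (F₂ j) : ℝ)), hR, hN,
      sum_pow_add_eq_sum_graded]
    refine Finset.sum_congr rfl fun s _ => ?_
    unfold gradedCount
    push_cast
    rfl
  have e3 : ∑ k ∈ R ×ˢ R, (q ^ 2)⁻¹ * q ^ (k.1 + k.2) * (fibreCount M u₀ (S₀ k.1) (S₀ k.2) : ℝ) =
      (q ^ 2)⁻¹ * ∑ k ∈ R ×ˢ R, q ^ (k.1 + k.2) * (fibreCount M u₀ (S₀ k.1) (S₀ k.2) : ℝ) := by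
    rw [Finset.mul_sum]; exact Finset.sum_congr rfl fun k _ => by ring
  rw [Finset.sum_sub_distrib, Finset.sum_sub_distrib, e3, regroup G₁ G₂, regroup A₁ A₂, regroup S₀ S₀]
  -- the square term re-indexed: levels `0, 1` of the three-arm event are empty
  have hS0 : ∀ s < 2, (gradedCount M u₀ S₀ S₀ s : ℝ) = 0 := by
    intro s hs
    unfold gradedCount
    push_cast
    refine Finset.sum_eq_zero fun i _ => Finset.sum_eq_zero fun j _ => ?_
    split_ifs with hij
    · have hi : i < 3 := by omega
      rw [show S₀ i = ∅ by rw [hS₀]; simp only; rw [threeArmEv_inter_levelSet_eq_empty a c v y hi, inter_empty],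
        fibreCount_eq_zero_of_left M u₀ rfl]
      simp
    · rfl
  have shift : ∑ s ∈ Finset.range (2 * N + 1), q ^ s * (gradedCount M u₀ S₀ S₀ s : ℝ) ≤
      q ^ 2 * ∑ s ∈ Finset.range (2 * N + 1), q ^ s * (gradedCount M u₀ S₀ S₀ (s + 2) : ℝ) := by
    rcases Nat.lt_or_ge (2 * N) 2 with hsmall | hbig
    · -- `N = 0`: only `s = 0`
      have hN0 : N = 0 := by omega
      rw [hN0]
      simp [hS0 0 (by norm_num)]
      positivity
    · obtain ⟨K, hK⟩ : ∃ K, 2 * N + 1 = K + 3 := ⟨2 * N - 2, by omega⟩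
      rw [hK]
      exact sum_pow_le_sq_mul_sum_shift q hq.le K _ (hS0 0 (by norm_num)) (hS0 1 (by norm_num)) fun s => by positivity
  have hq2 : (q ^ 2)⁻¹ * (q ^ 2) = 1 := inv_mul_cancel₀ (by positivity)
  have main : ∑ s ∈ Finset.range (2 * N + 1), q ^ s * (gradedCount M u₀ A₁ A₂ s : ℝ) +
      ∑ s ∈ Finset.range (2 * N + 1), q ^ s * (gradedCount M u₀ S₀ S₀ (s + 2) : ℝ) ≤
      ∑ s ∈ Finset.range (2 * N + 1), q ^ s * (gradedCount M u₀ G₁ G₂ s : ℝ) := by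
    rw [← Finset.sum_add_distrib]
    refine Finset.sum_le_sum fun s _ => ?_
    rw [← mul_add]
    exact mul_le_mul_of_nonneg_left (node s) (pow_nonneg hq.le s)
  have hsq : (q ^ 2)⁻¹ * ∑ s ∈ Finset.range (2 * N + 1), q ^ s * (gradedCount M u₀ S₀ S₀ s : ℝ) ≤
      ∑ s ∈ Finset.range (2 * N + 1), q ^ s * (gradedCount M u₀ S₀ S₀ (s + 2) : ℝ) := by
    calc (q ^ 2)⁻¹ * ∑ s ∈ Finset.range (2 * N + 1), q ^ s * (gradedCount M u₀ S₀ S₀ s : ℝ)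
        ≤ (q ^ 2)⁻¹ * (q ^ 2 * ∑ s ∈ Finset.range (2 * N + 1), q ^ s * (gradedCount M u₀ S₀ S₀ (s + 2) : ℝ)) :=
          mul_le_mul_of_nonneg_left shift (by positivity)
      _ = _ := by rw [← mul_assoc, hq2, one_mul]
  linarith

/-- **Conjecture R_q ⇒ opposite-seed edge negative correlation for `φ_{w,q}` given `a ↮ c`, every `q > 0`**:
`Z₁₁(q)·Z₀₀(q) ≤ Z₁₀(q)·Z₀₁(q)` (drop the square). [cite: VandenbergHaggstromKahn2005, Thm. 1.4 (p. 7); Thm. 2.1 (p. 9)]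
[cite: Grimmett2006, §3.9 eq. (3.94) (p. 63)] -/
theorem rc_seedNegCorr_of_gradedOn (h : TwoClusterRayleighGradedOn V) (w : Sym2 V → unitInterval) {q : ℝ} (hq : 0 < q)
    (a c u v x y : V)
    (hau : (sureGraph (Function.update (Function.update w s(u, v) 0) s(x, y) 0)).Reachable a u)
    (hcx : (sureGraph (Function.update (Function.update w s(u, v) 0) s(x, y) 0)).Reachable c x) :
    ((rcMeasureW (Function.update (Function.update w s(u, v) 1) s(x, y) 1) q ∅).real (sepEv a c) *
        rcPartitionFunctionW (Function.update (Function.update w s(u, v) 1) s(x, y) 1) q ∅) *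
      ((rcMeasureW (Function.update (Function.update w s(u, v) 0) s(x, y) 0) q ∅).real (sepEv a c) *
        rcPartitionFunctionW (Function.update (Function.update w s(u, v) 0) s(x, y) 0) q ∅) ≤
      ((rcMeasureW (Function.update (Function.update w s(u, v) 1) s(x, y) 0) q ∅).real (sepEv a c) *
        rcPartitionFunctionW (Function.update (Function.update w s(u, v) 1) s(x, y) 0) q ∅) *
      ((rcMeasureW (Function.update (Function.update w s(u, v) 0) s(x, y) 1) q ∅).real (sepEv a c) *
        rcPartitionFunctionW (Function.update (Function.update w s(u, v) 0) s(x, y) 1) q ∅) := by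
  have key := rc_sq_ineq_of_gradedOn h w hq a c u v x y hau hcx
  nlinarith [mul_nonneg (inv_nonneg.2 (pow_nonneg hq.le 2))
    (sq_nonneg ((rcMeasureW (Function.update (Function.update w s(u, v) 0) s(x, y) 0) q ∅).real (threeArmEv a c v y) *
      rcPartitionFunctionW (Function.update (Function.update w s(u, v) 0) s(x, y) 0) q ∅))]

end FK

end Summit.CriticalPhenomena.PercolationContinuityZ3.Theorems

end
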